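import Summits.CriticalPhenomena.Ising3DConformalLimit.Theses.PerfectScreening

/-!
# Crux `PerfectScreening.SubharmonicOffOrigin` (stmt-CriticalPhenomena-1341): objects of the line
`kl-band-positivity`

Definitions only (no stub proofs) shared by the positive-side files of this crux, i.e. by the
registered stubs of the checked skeleton
`Cruxes/SubharmonicOffOrigin/Lines/kl_band_positivity.lean` (lead
`prover-line-stmt-CriticalPhenomena-1341-0`, 2026-08-16) and by its composition theorem
`SubharmonicOffOrigin_of`:

* §A spectral coordinates seen from a transfer direction `i₀ : Fin 3`: the transverse coordinates
  `perp`, the transverse momentum symbol `khatSq` (`k̂² = ∑ⱼ 2(1 − cos kⱼ)`), the phase `phase`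
  (`k·y`), the ISO-MASS LAYER SYMBOL `layerSymbol θ k = λ_θ(k)` (small root of
  `λ + 1/λ = θ + 1/θ + k̂²`), the iso-mass fibre function `isoMassFun` and its first-layer profile
  `layerOne`;
* §B the spectral window `specWindow = (0,1] × ℝ²`, the free invariant mass `freeMass`
  (`s = λ + 1/λ − 2 − k̂²`), the LSC-violating region `lscViolating = {s < 0}`, momentum test functions
  `IsMomentumTest`, edge saturation `EdgeSaturated`, joint spectral representations `Represents`,
  iso-mass (Källén–Lehmann) representations `IsoMassRep`, first-layer fibre positivity
  `FibrePositive`;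
* §C the six stub SIGNATURES `Sig.stub_jointSpectralMeasure`, `Sig.stub_exactLightCone`,
  `Sig.stub_isoMassDisintegration`, `Sig.stub_fibrePositivity`, `Sig.stub_layerKernel`,
  `Sig.stub_bandSubharmonic` (registered on stmt-CriticalPhenomena-1341 by `ledger skeleton check`).

Statements are verbatim those of the planner's checked skeleton
(planner-cruxplan-stmt-CriticalPhenomena-1341-kl-band-positivity-0, v2) with ONE lead reshape:
`Sig.stub_layerKernel` is stated EXISTENTIALLY (some nonnegative summable kernel `P` on `ℤ²` with
cosine series `λ_θ(k)ⁿ`), which is all the band lemma consumes; the integral formula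
`P_θ^{(n)}(y) = (2π)⁻² ∫_{[-π,π]²} λ_θ(k)ⁿ cos(k·y) dk` of the skeleton's `poissonLayer` is then a
consequence (uniqueness of cosine coefficients) and is not needed by the composition.

Mathematical content (why these objects): reflection positivity in direction `i₀` gives a joint
spectral measure `ρ ≥ 0` of (transfer matrix, transverse translations) with
`G(x) = ∫ λ^{|x_{i₀}|} cos(k·x̌) dρ(λ,k)`; re-coordinatising by the lattice invariant mass
(`λ + 1/λ = θ + 1/θ + k̂²`) every iso-mass fibre `u_θ(x) = ∫ λ_θ(k)^{|n|} cos(k·y) dκ_θ(k)` solves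
the massive lattice Helmholtz equation `Δ_{ℤ³} u_θ = ((1−θ)²/θ)·u_θ` off the source plane (the
7-point stencil is diagonal in iso-mass variables: `λ² − (2+k̂²)λ + 1 = ((1−θ)²/θ)λ`) and propagates
from the first layer by positive `ℓ¹` kernels with symbol `λ_θⁿ`; so first-layer fibre positivity
gives `ΔG(x) = ∫ ((1−θ)²/θ) u_θ(x) dm(θ) ≥ 0` at every `x` off the plane.
-/

noncomputable section

open MeasureTheory ProbabilityTheory
open Literature.Probability.LatticeModels

namespace Summit.CriticalPhenomena.Ising3DConformalLimit.Theorems.PerfectScreening.KlBand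

/-! ## A. Spectral coordinates seen from a transfer direction -/

/-- The two transverse coordinates of `x ∈ ℤ³` seen from the transfer direction `i₀`
(`x̌ j = x (i₀.succAbove j)`). -/
def perp (i₀ : Fin 3) (x : Site 3) : Fin 2 → ℤ := fun j => x (i₀.succAbove j)

/-- The transverse lattice momentum symbol `k̂² = ∑ⱼ 2(1 − cos kⱼ)` on the momentum torus `𝕋²`
(written on `ℝ²`; everything below is `2π`-periodic in each `kⱼ`). -/
def khatSq (k : Fin 2 → ℝ) : ℝ := ∑ j, 2 * (1 - Real.cos (k j))

/-- The phase `k·y`. -/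
def phase (k : Fin 2 → ℝ) (y : Fin 2 → ℤ) : ℝ := ∑ j, k j * (y j : ℝ)

/-- The ISO-MASS LAYER SYMBOL `λ_θ(k) ∈ [0,1]`: the small root of `λ + 1/λ = θ + 1/θ + k̂²(k)`, i.e.
`λ_θ(k) = e^{−E_θ(k)}` with `2cosh E_θ(k) = 2 + s + k̂²`, lattice invariant mass
`s = (1−θ)²/θ = θ + 1/θ − 2` (`θ = λ_θ(0)` is the rest-frame decay rate; `θ = 1` is the free MASSLESS
dispersion `E₁ = ω₀(k) = arccosh(1 + k̂²/2)`, `θ → 0⁺` is infinite mass).  Closed form of the small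
root of `θλ² − (1 + θ² + θk̂²)λ + θ = 0`, continuous down to `θ = 0` (where it is `0`). -/
def layerSymbol (θ : ℝ) (k : Fin 2 → ℝ) : ℝ :=
  2 * θ / ((1 + θ ^ 2 + θ * khatSq k) + Real.sqrt ((1 + θ ^ 2 + θ * khatSq k) ^ 2 - 4 * θ ^ 2))

/-- `k̂² ≥ 0`. -/
theorem khatSq_nonneg (k : Fin 2 → ℝ) : 0 ≤ khatSq k := by
  unfold khatSq
  refine Finset.sum_nonneg fun j _ => ?_
  have := Real.cos_le_one (k j)
  linarith

/-- **The defining quadratic of the layer symbol** (registered sub-goal `layerSymbol_quadratic` of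
stmt-CriticalPhenomena-1341): for `θ > 0` and every `k`, `λ = layerSymbol θ k` is a root of
`θλ² − (1 + θ² + θk̂²)λ + θ = 0`, i.e. `λ + 1/λ = θ + 1/θ + k̂²` — the HELMHOLTZ IDENTITY
`λ² − (2 + k̂²)λ + 1 = ((1−θ)²/θ)·λ` of the 7-point stencil in iso-mass variables, used by the
disintegration (stub 3) and the band lemma (stub 6).  Proof: with `B = 1 + θ² + θk̂²`, `B ≥ 2θ`
(`B − 2θ = (1−θ)² + θk̂²`), `S = √(B² − 4θ²)`, `λ = 2θ/(B+S)` and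
`θλ² − Bλ + θ = θ(4θ² − B² + S²)/(B+S)² = 0`. -/
theorem layerSymbol_quadratic :
    ∀ θ : ℝ, 0 < θ → ∀ k : Fin 2 → ℝ,
      θ * layerSymbol θ k ^ 2 - (1 + θ ^ 2 + θ * khatSq k) * layerSymbol θ k + θ = 0 := by
  intro θ hθ k
  have hk := khatSq_nonneg k
  set B : ℝ := 1 + θ ^ 2 + θ * khatSq k with hB
  have hB2 : 2 * θ ≤ B := by
    have h1 : B - 2 * θ = (1 - θ) ^ 2 + θ * khatSq k := by rw [hB]; ring
    nlinarith [sq_nonneg (1 - θ), mul_nonneg hθ.le hk]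
  have hBpos : 0 < B := by linarith
  have hdisc : 0 ≤ B ^ 2 - 4 * θ ^ 2 := by nlinarith
  set S : ℝ := Real.sqrt (B ^ 2 - 4 * θ ^ 2) with hS
  have hS0 : 0 ≤ S := Real.sqrt_nonneg _
  have hS2 : S ^ 2 = B ^ 2 - 4 * θ ^ 2 := by rw [hS, Real.sq_sqrt hdisc]
  have hden : 0 < B + S := by linarith
  have hlam : layerSymbol θ k = 2 * θ / (B + S) := by
    simp only [layerSymbol, hB, hS]
  rw [hlam]
  field_simp
  nlinarith [hS2]

/-- The ISO-MASS FIBRE FUNCTION of a (finite, `k ↦ −k`-symmetrisable) fibre measure `ν` on the momentum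
torus, in direction `i₀`: `u_θ[ν](x) = ∫ λ_θ(k)^{|x_{i₀}|} cos(k · x̌) dν(k)`. -/
def isoMassFun (i₀ : Fin 3) (θ : ℝ) (ν : Measure (Fin 2 → ℝ)) (x : Site 3) : ℝ :=
  ∫ k, layerSymbol θ k ^ (x i₀).natAbs * Real.cos (phase k (perp i₀ x)) ∂ν

/-- The FIRST-LAYER PROFILE of a fibre: `w_θ[ν](y) = ∫ λ_θ(k) cos(k·y) dν(k)` (= `u_θ[ν]` at `(1, y)`). -/
def layerOne (θ : ℝ) (ν : Measure (Fin 2 → ℝ)) (y : Fin 2 → ℤ) : ℝ :=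
  ∫ k, layerSymbol θ k * Real.cos (phase k y) ∂ν

/-! ## B. Spectral window, light cone, representations -/

/-- The spectral window `(0,1] × (momentum space)`: transfer-matrix eigenvalue ratios `λ ∈ (0,1]`
(positivity of the transfer matrix; NO atom at `λ = 0`). -/
def specWindow : Set (ℝ × (Fin 2 → ℝ)) := Set.Ioc (0 : ℝ) 1 ×ˢ Set.univ

/-- The FREE INVARIANT MASS of a spectral point: `s(λ,k) = λ + 1/λ − 2 − k̂²(k)` (`= 2cosh E − 2 − k̂²` for
`λ = e^{−E}`); `s = 0` is the free massless lattice dispersion `E = ω₀(k) = arccosh(1 + k̂²/2)` (the lattice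
light cone), `s > 0` above it, `s < 0` below it. -/
def freeMass (p : ℝ × (Fin 2 → ℝ)) : ℝ := p.1 + p.1⁻¹ - 2 - khatSq p.2

/-- The LSC-VIOLATING region: spectral weight strictly BELOW the free lattice dispersion, `s < 0`
(⟺ `λ + 1/λ < 2 + k̂²` ⟺ `E < ω₀(k)`). -/
def lscViolating : Set (ℝ × (Fin 2 → ℝ)) := {p | freeMass p < 0}

/-- Admissible MOMENTUM TEST FUNCTIONS: continuous, nonnegative, even and `2πℤ²`-periodic functions of `k`
(they see a representing measure only through its canonical even/periodic version, so statements made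
with them do not depend on which representing measure is chosen). -/
def IsMomentumTest (φ : (Fin 2 → ℝ) → ℝ) : Prop :=
  Continuous φ ∧ (∀ k, 0 ≤ φ k) ∧ (∀ k, φ (-k) = φ k) ∧
    ∀ (k : Fin 2 → ℝ) (z : Fin 2 → ℤ), φ (k + fun j => 2 * Real.pi * (z j : ℝ)) = φ k

/-- EDGE SATURATION of a joint spectral measure: in every momentum window that carries spectral weight
there is weight of free invariant mass `< ε` for every `ε > 0` — the essential spectral edge sits ON the
free lattice light cone wherever there is spectrum (together with LSC: the edge IS the light cone). -/
def EdgeSaturated (ρ : Measure (ℝ × (Fin 2 → ℝ))) : Prop :=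
  ∀ φ : (Fin 2 → ℝ) → ℝ, IsMomentumTest φ → 0 < ∫ p, φ p.2 ∂ρ →
    ∀ ε : ℝ, 0 < ε → 0 < ∫ p in {p | freeMass p < ε}, φ p.2 ∂ρ

/-- `ρ` is a JOINT SPECTRAL MEASURE of `G` in direction `i₀`:
`G(x) = ∫ λ^{|x_{i₀}|} cos(k · x̌) dρ(λ,k)` for every `x ∈ ℤ³` (plane `x_{i₀} = 0` included). -/
def Represents (i₀ : Fin 3) (G : Site 3 → ℝ) (ρ : Measure (ℝ × (Fin 2 → ℝ))) : Prop :=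
  ∀ x : Site 3, G x = ∫ p, p.1 ^ (x i₀).natAbs * Real.cos (phase p.2 (perp i₀ x)) ∂ρ

/-- An ISO-MASS (Källén–Lehmann) REPRESENTATION of `G` in direction `i₀`: a finite mass measure `m` on
the rest-frame decay rates `θ ∈ (0,1]` (equivalently on invariant masses `s = (1−θ)²/θ ∈ [0,∞)`) and a
Markov kernel of fibre measures `κ θ` on the momentum torus with `G = ∫ u_θ[κ θ] dm(θ)` pointwise on `ℤ³`.
(`integrable` is a convenience field: it follows from the others since `|u_θ| ≤ 1` `m`-a.e.) -/
structure IsoMassRep (i₀ : Fin 3) (G : Site 3 → ℝ) (m : Measure ℝ) (κ : Kernel ℝ (Fin 2 → ℝ)) : Prop where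
  finite : IsFiniteMeasure m
  markov : IsMarkovKernel κ
  window : m (Set.Ioc (0 : ℝ) 1)ᶜ = 0
  integrable : ∀ x : Site 3, Integrable (fun θ => isoMassFun i₀ θ (κ θ) x) m
  repr : ∀ x : Site 3, G x = ∫ θ, isoMassFun i₀ θ (κ θ) x ∂m

/-- FIRST-LAYER FIBRE POSITIVITY of an iso-mass representation: for `m`-a.e. massive fibre (`θ < 1`;
the massless fibre `θ = 1` carries Laplacian weight `0` and is not constrained) the first-layer profile
is a nonnegative function on `ℤ²`. -/
def FibrePositive (m : Measure ℝ) (κ : Kernel ℝ (Fin 2 → ℝ)) : Prop :=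
  ∀ᵐ θ ∂m, θ < 1 → ∀ y : Fin 2 → ℤ, 0 ≤ layerOne θ (κ θ) y

/-! ## C. The six registered stub signatures of the line -/

/-- **Signature of stub 1 (support, known; size L).** JOINT SPECTRAL MEASURE in every coordinate direction:
for each `i₀` there is a finite positive measure `ρ` on `(0,1] × 𝕋²` with
`⟨σ₀σ_x⟩⁺_{β_c(3)} = ∫ λ^{|x_{i₀}|} cos(k·x̌) dρ(λ,k)` for ALL `x ∈ ℤ³` (bond reflection positivity ⇒
transfer matrix `0 ≤ T ≤ 1` commuting with unitary layer translations, Glimm–Jaffe 1987 §6.1 /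
Aizenman–Duminil-Copin 2021 Prop. 5.3, App. Prop. 8.6; Bochner on the `*`-semigroup `ℕ × ℤ²`,
Berg–Christensen–Ressel 1984 Ch. 4 Thm 2.8; no atom at `λ = 0`). -/
def Sig.stub_jointSpectralMeasure : Prop :=
  ∀ i₀ : Fin 3, ∃ ρ : Measure (ℝ × (Fin 2 → ℝ)), IsFiniteMeasure ρ ∧ ρ specWindowᶜ = 0 ∧
    Represents i₀ (criticalTwoPoint 3) ρ

/-- **Signature of stub 2 (CRUX-level, open; the line's sharp kill).** EXACT LIGHT CONE at `β_c(3)`: every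
joint spectral measure of the critical two-point function (any direction) (i) charges nothing strictly below
the free lattice dispersion — the LATTICE SPECTRAL CONDITION `ρ{s < 0} = 0` — AND (ii) is EDGE-SATURATED:
wherever in momentum space it has weight, it has weight of free invariant mass `< ε` for every `ε > 0`
(the essential edge of the critical spin spectrum at transverse momentum `k` is EXACTLY
`ω₀(k) = arccosh(1 + k̂²/2)`; a theorem in `d = 2` by duality + free fermions, a conjecture in `d = 3`). -/
def Sig.stub_exactLightCone : Prop :=
  ∀ (i₀ : Fin 3) (ρ : Measure (ℝ × (Fin 2 → ℝ))), IsFiniteMeasure ρ → ρ specWindowᶜ = 0 →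
    Represents i₀ (criticalTwoPoint 3) ρ → ρ lscViolating = 0 ∧ EdgeSaturated ρ

/-- **Signature of stub 3 (support; size M).** ISO-MASS DISINTEGRATION: a joint spectral measure on
`(0,1] × 𝕋²` obeying LSC disintegrates along the lattice invariant mass into an iso-mass representation
(for ANY represented function `G`): push `ρ` forward under `(λ,k) ↦ (θ(λ,k), k)` with
`θ(λ,k) = 2/(c + √(c²−4))`, `c = λ + 1/λ − k̂² ≥ 2`, so that `layerSymbol (θ(λ,k)) k = λ`; then
`m := ρ'.fst`, `κ := ρ'.condKernel` (`MeasureTheory.Measure.condKernel`, standard Borel `ℝ × ℝ²`). -/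
def Sig.stub_isoMassDisintegration : Prop :=
  ∀ (G : Site 3 → ℝ) (i₀ : Fin 3) (ρ : Measure (ℝ × (Fin 2 → ℝ))), IsFiniteMeasure ρ →
    ρ specWindowᶜ = 0 → ρ lscViolating = 0 → Represents i₀ G ρ →
      ∃ (m : Measure ℝ) (κ : Kernel ℝ (Fin 2 → ℝ)), IsoMassRep i₀ G m κ

/-- **Signature of stub 4 (CRUX-level, open; the HARDEST).** FIRST-LAYER FIBRE POSITIVITY at `β_c(3)`,
CONDITIONAL ON THE EXACT LIGHT CONE: if stub 2 holds, then in any iso-mass representation of the critical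
two-point function, `m`-a.e. massive fibre has a nonnegative first-layer profile on `ℤ²` (an identity with
room for the Lorentz-invariant continuum Källén–Lehmann fibre `dk/(2E_s)`, whose first-layer profile is the
massive free propagator `G_s((1,y)) > 0`; exact in the 2D one-particle sector, Bugrij–Lisovyy
arXiv:0708.3643 eqs. (32)–(35)). -/
def Sig.stub_fibrePositivity : Prop :=
  Sig.stub_exactLightCone → ∀ (i₀ : Fin 3) (m : Measure ℝ) (κ : Kernel ℝ (Fin 2 → ℝ)),
    IsoMassRep i₀ (criticalTwoPoint 3) m κ → FibrePositive m κ

/-- **Signature of stub 5 (support; size M) — lead reshape: EXISTENTIAL layer kernels.** For every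
MASSIVE rate `θ ∈ (0,1)` and every `n`, the power `λ_θ(·)ⁿ` of the layer symbol is the cosine series of a
NONNEGATIVE SUMMABLE kernel on `ℤ²`: some `P ≥ 0` with `∑_y P(y) < ∞` and
`λ_θ(k)ⁿ = ∑_y P(y) cos(k·y)` for every `k ∈ ℝ²` (pointwise `HasSum`).  Why true: with
`c = 2cos k₁ + 2cos k₂ ∈ [−4,4]` and `t = θ + 1/θ + 4 − c > 2`, `λ_θ = (t − √(t²−4))/2 = ∑_{m≥0} C_m t^{−2m−1}`
(Catalan numbers) and `t^{−j} = ∑_i (i+j−1 choose i) c^i (θ+1/θ+4)^{−i−j}` converge absolutely up to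
`c = 4 < θ + 1/θ + 2` (`θ ≠ 1`), so `λ_θⁿ` is ABSOLUTELY MONOTONE in `c`, and
`c^i = ∑_y N_i(y) cos(k·y)` with `N_i(y) ≥ 0` the number of `i`-step nearest-neighbour walks `0 → y` in
`ℤ²` (`∑_y N_i(y) = 4^i`); Fubini for nonnegative series.  (The kernel is then unique — the massive
half-space Poisson kernel `P_θ^{(n)} = IDFT[λ_θⁿ]`, the first-entrance law into the plane at height `n` of
the killed simple random walk — but uniqueness is not part of the signature.) -/
def Sig.stub_layerKernel : Prop :=
  ∀ θ : ℝ, θ ∈ Set.Ioo (0 : ℝ) 1 → ∀ n : ℕ, ∃ P : (Fin 2 → ℤ) → ℝ,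
    (∀ y, 0 ≤ P y) ∧ Summable P ∧
      ∀ k : Fin 2 → ℝ, HasSum (fun y => P y * Real.cos (phase k y)) (layerSymbol θ k ^ n)

/-- **Signature of stub 6 (support, the BAND LEMMA; size M).** Given the layer-kernel facts, an iso-mass
representation with first-layer fibre positivity is lattice-subharmonic at every site off its source plane
`{x_{i₀} = 0}` — for ANY function `G` so represented (Helmholtz identity
`λ² − (2 + k̂²)λ + 1 = ((1−θ)²/θ)·λ` of the stencil in iso-mass variables for `m`-a.e. `θ ∈ (0,1]`,
`cos(k·(y+eⱼ)) + cos(k·(y−eⱼ)) = 2cos(k·y)cos kⱼ`, linearity of `∫ · dm` over the seven stencil points,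
then `u_θ(n,y) = ½ ∑_z P(z) (w_θ(y−z) + w_θ(y+z)) ≥ 0` by stub 5 at exponent `|n| − 1`, Fubini against the
finite fibre measure and first-layer positivity; the massless fibre `θ = 1` has weight `0`). -/
def Sig.stub_bandSubharmonic : Prop :=
  Sig.stub_layerKernel → ∀ (G : Site 3 → ℝ) (i₀ : Fin 3) (m : Measure ℝ) (κ : Kernel ℝ (Fin 2 → ℝ)),
    IsoMassRep i₀ G m κ → FibrePositive m κ → ∀ x : Site 3, x i₀ ≠ 0 →
      6 * G x ≤ ∑ i : Fin 3, (G (x + Pi.single i 1) + G (x - Pi.single i 1))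

end Summit.CriticalPhenomena.Ising3DConformalLimit.Theorems.PerfectScreening.KlBand

end
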